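import Mathlib.Combinatorics.SimpleGraph.Cayley
import Mathlib.Combinatorics.SimpleGraph.Copy
import Mathlib.Combinatorics.SimpleGraph.Connectivity.Connected
import Mathlib.GroupTheory.OrderOfElement
import Mathlib.Data.ZMod.Basic
import Mathlib.Tactic.Abel
import Mathlib.Tactic.Ring
import HarnessLib

/-!
# Toric layouts (Bravyi et al. 2024, Definition 1): the Cayley graph of `ℤ_{2μ} × ℤ_{2λ}`, spanning
# torus subgraphs, and the torus parametrisation `(p, q) ↦ p•α + q•β` of an abelian group

Bravyi–Cross–Gambetta–Maslov–Rall–Yoder [BravyiEtAl2024, §5]: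

* "the undirected Cayley graph of a finite Abelian group `𝒢` … generated by set `S ⊂ 𝒢` is the graph
  with vertex set `𝒢` and undirected edges `(g, g+s)` for all `g ∈ 𝒢` and all `s ∈ S`, `s ≠ 0`. We say
  the Cayley graph of `ℤ_a × ℤ_b` when we mean the Cayley graph of `ℤ_a × ℤ_b` generated by
  `{(1,0),(0,1)}`" — `torusGraph a b` below (= Mathlib's `SimpleGraph.addCayley`);
* **Definition 1.** "Code `QC(A,B)` is said to have a toric layout if its Tanner graph has a spanning
  sub-graph isomorphic to the Cayley graph of `ℤ_{2μ} × ℤ_{2λ}` for some integers `μ` and `λ`" —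
  `HasToricLayoutWith μ ν Γ` (a bijection from `ℤ_{2μ} × ℤ_{2ν}` onto the vertices of `Γ` carrying
  torus edges to edges of `Γ`; `ν` is the printed `λ`, a reserved word in Lean) and `HasToricLayout Γ`
  (`∃ μ, ν ≥ 1`), stated for an arbitrary `SimpleGraph` so that any code's Tanner graph can be plugged in;
* "only codes with connected Tanner graphs can have a toric layout" — `HasToricLayout.connected`
  (the torus graph is connected, `torusGraph_connected`).

Generic ingredients of the proof of Lemma 4 (the two-block layout itself is
`TwoBlockToricLayout.lean`): the parity decomposition `ℤ_{2n} → ℤ_n × Bool` of a torus coordinate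
`c = 2a + ε` (`half`, `par`, how they change under `c ↦ c + 1`, injectivity), and the torus
parametrisation `torusHom α β : ℤ_{ord α} × ℤ_{ord β} →+ G`, `(p, q) ↦ p•α + q•β`, which is a bijection
when `⟨α, β⟩ = G` and `ord α · ord β = |G|` ("because of (ii) and the pigeonhole principle, this choice
of `(a, b)` is unique").

## References (locators read on the page)
* [BravyiEtAl2024] Nature 627 (2024) 778 = arXiv:2308.07915, §5: Cayley-graph conventions,
  Definition 1 and the remark after it, Lemma 4 and its proof (held text paper:arxiv-2308.07915
  chunk p0011 L21–36).

No named facts, no instances, no notation. Mathlib: `SimpleGraph.addCayley`, `SimpleGraph.IsContained`,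
`ZMod`, `addOrderOf`, `mod_addOrderOf_nsmul` (`lean search` 2026-08-27: no torus/Cayley layout notion
for codes in the tree).
-/

namespace Literature.InformationTheory.QuantumCodes

open SimpleGraph

/-! ### Definition 1: the torus Cayley graph and toric layouts -/

/-- The (undirected) Cayley graph of `ℤ_{n₁} × ℤ_{n₂}` generated by `{(1,0), (0,1)}`: vertices
`ℤ_{n₁} × ℤ_{n₂}`, edges `(g, g + s)`, `s ∈ {(1,0),(0,1)}` (Mathlib's `SimpleGraph.addCayley`).
[cite: BravyiEtAl2024, §5 "We say the Cayley graph of ℤ_a × ℤ_b when we mean the Cayley graph of ℤ_a × ℤ_b generated by {(1,0),(0,1)}" (arXiv:2308.07915 chunk p0011 L21)] -/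
def torusGraph (n₁ n₂ : ℕ) : SimpleGraph (ZMod n₁ × ZMod n₂) :=
  SimpleGraph.addCayley ({((1 : ZMod n₁), (0 : ZMod n₂)), ((0 : ZMod n₁), (1 : ZMod n₂))} :
    Set (ZMod n₁ × ZMod n₂))

/-- Adjacency in the torus graph: `u ≠ v` and `v = u ± (1,0)` or `v = u ± (0,1)`.
[cite: BravyiEtAl2024, §5 "undirected edges (g, g+s) for all g ∈ 𝒢 and all s ∈ S, s ≠ 0" (arXiv:2308.07915 chunk p0011 L21)] -/
theorem torusGraph_adj_iff {n₁ n₂ : ℕ} (u v : ZMod n₁ × ZMod n₂) :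
    (torusGraph n₁ n₂).Adj u v ↔ u ≠ v ∧
      (u + (1, 0) = v ∨ u = v + (1, 0) ∨ u + (0, 1) = v ∨ u = v + (0, 1)) := by
  rw [torusGraph, addCayley_adj']
  simp only [Set.mem_insert_iff, Set.mem_singleton_iff, exists_eq_or_imp, exists_eq_left]
  tauto

/-- Every torus edge is `{u, u + (1,0)}` or `{u, u + (0,1)}` for some `u` (up to orientation).
[cite: BravyiEtAl2024, §5 (arXiv:2308.07915 chunk p0011 L21)] -/
theorem torusGraph_adj_cases {n₁ n₂ : ℕ} {u v : ZMod n₁ × ZMod n₂} (h : (torusGraph n₁ n₂).Adj u v) :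
    (v = u + (1, 0) ∨ u = v + (1, 0)) ∨ (v = u + (0, 1) ∨ u = v + (0, 1)) := by
  rw [torusGraph_adj_iff] at h
  rcases h.2 with h1 | h1 | h1 | h1
  · exact Or.inl (Or.inl h1.symm)
  · exact Or.inl (Or.inr h1)
  · exact Or.inr (Or.inl h1.symm)
  · exact Or.inr (Or.inr h1)

variable {V : Type*}

/-- **Definition 1 (with parameters)**: `Γ` has a toric layout on `ℤ_{2μ} × ℤ_{2ν}` if there is a
BIJECTION from `ℤ_{2μ} × ℤ_{2ν}` onto the vertices of `Γ` carrying every torus edge to an edge of `Γ`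
— i.e. `Γ` has a spanning subgraph isomorphic to the Cayley graph of `ℤ_{2μ} × ℤ_{2ν}`.
(`ν` is the printed `λ`.)
[cite: BravyiEtAl2024, Definition 1 "its Tanner graph has a spanning sub-graph isomorphic to the Cayley graph of ℤ_{2μ} × ℤ_{2λ}" (arXiv:2308.07915 chunk p0011 L24)] -/
def HasToricLayoutWith (μ ν : ℕ) (Γ : SimpleGraph V) : Prop :=
  ∃ f : ZMod (2 * μ) × ZMod (2 * ν) → V, Function.Bijective f ∧
    ∀ u v, (torusGraph (2 * μ) (2 * ν)).Adj u v → Γ.Adj (f u) (f v)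

/-- **Definition 1**: `Γ` has a toric layout if it has one on `ℤ_{2μ} × ℤ_{2ν}` for some `μ, ν ≥ 1`.
[cite: BravyiEtAl2024, Definition 1 "for some integers μ and λ" (arXiv:2308.07915 chunk p0011 L24)] -/
def HasToricLayout (Γ : SimpleGraph V) : Prop :=
  ∃ μ ν : ℕ, 0 < μ ∧ 0 < ν ∧ HasToricLayoutWith μ ν Γ

/-- A toric layout exhibits the torus graph as a subgraph in Mathlib's sense (`⊑`, an injective
homomorphism). [cite: BravyiEtAl2024, Definition 1 (arXiv:2308.07915 chunk p0011 L24)] -/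
theorem HasToricLayoutWith.isContained {μ ν : ℕ} {Γ : SimpleGraph V} (h : HasToricLayoutWith μ ν Γ) :
    (torusGraph (2 * μ) (2 * ν)).IsContained Γ := by
  obtain ⟨f, hf, hadj⟩ := h
  exact ⟨⟨⟨f, fun {u} {v} huv => hadj u v huv⟩, hf.1⟩⟩

/-! ### The torus graph is connected; a toric layout forces a connected Tanner graph -/

section TorusConnected

variable {n₁ n₂ : ℕ} [NeZero n₁] [NeZero n₂]

omit [NeZero n₁] [NeZero n₂] in
/-- `u` and `u + (k, 0)` are joined in the torus graph. [cite: BravyiEtAl2024, §5 (arXiv:2308.07915 chunk p0011 L21–26)] -/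
theorem torusGraph_reachable_add_fst (u : ZMod n₁ × ZMod n₂) (k : ℕ) :
    (torusGraph n₁ n₂).Reachable u (u + ((k : ZMod n₁), 0)) := by
  induction k with
  | zero => rw [Nat.cast_zero, show (((0 : ZMod n₁), (0 : ZMod n₂)) : ZMod n₁ × ZMod n₂) = 0 from rfl, add_zero]
  | succ k ih =>
    refine ih.trans ?_
    by_cases h : u + ((k : ZMod n₁), 0) = u + (((k + 1 : ℕ) : ZMod n₁), 0)
    · rw [← h]
    · refine Adj.reachable ((torusGraph_adj_iff _ _).mpr ⟨h, Or.inl ?_⟩)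
      simp only [Prod.mk_add_mk, add_zero, Nat.cast_succ, add_assoc]

omit [NeZero n₁] [NeZero n₂] in
/-- `u` and `u + (0, k)` are joined in the torus graph. [cite: BravyiEtAl2024, §5 (arXiv:2308.07915 chunk p0011 L21–26)] -/
theorem torusGraph_reachable_add_snd (u : ZMod n₁ × ZMod n₂) (k : ℕ) :
    (torusGraph n₁ n₂).Reachable u (u + (0, (k : ZMod n₂))) := by
  induction k with
  | zero => rw [Nat.cast_zero, show (((0 : ZMod n₁), (0 : ZMod n₂)) : ZMod n₁ × ZMod n₂) = 0 from rfl, add_zero]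
  | succ k ih =>
    refine ih.trans ?_
    by_cases h : u + (0, (k : ZMod n₂)) = u + (0, ((k + 1 : ℕ) : ZMod n₂))
    · rw [← h]
    · refine Adj.reachable ((torusGraph_adj_iff _ _).mpr ⟨h, Or.inr (Or.inr (Or.inl ?_))⟩)
      simp only [Prod.mk_add_mk, add_zero, Nat.cast_succ, add_assoc]

/-- The torus graph `ℤ_{n₁} × ℤ_{n₂}` (`n₁, n₂ ≥ 1`) is connected. [cite: BravyiEtAl2024, §5 (arXiv:2308.07915 chunk p0011 L21–26)] -/
theorem torusGraph_connected : (torusGraph n₁ n₂).Connected := by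
  rw [connected_iff_exists_forall_reachable]
  refine ⟨(0, 0), fun w => ?_⟩
  have h1 := torusGraph_reachable_add_fst ((0 : ZMod n₁), (0 : ZMod n₂)) w.1.val
  have h2 := torusGraph_reachable_add_snd (((w.1.val : ℕ) : ZMod n₁), (0 : ZMod n₂)) w.2.val
  simp only [Prod.mk_add_mk, zero_add, ZMod.natCast_zmod_val, add_zero] at h1 h2
  exact h1.trans h2

end TorusConnected

/-- "Only codes with connected Tanner graphs can have a toric layout."
[cite: BravyiEtAl2024, §5, remark after Definition 1 (arXiv:2308.07915 chunk p0011 L26)] -/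
theorem HasToricLayout.connected {Γ : SimpleGraph V} (h : HasToricLayout Γ) : Γ.Connected := by
  obtain ⟨μ, ν, hμ, hν, f, hf, hadj⟩ := h
  haveI : NeZero (2 * μ) := ⟨by omega⟩
  haveI : NeZero (2 * ν) := ⟨by omega⟩
  exact (torusGraph_connected (n₁ := 2 * μ) (n₂ := 2 * ν)).map
    ⟨f, fun {u} {v} huv => hadj u v huv⟩ hf.2

/-! ### Parity decomposition `ℤ_{2n} → ℤ_n × Bool` -/

section Parity

variable {n : ℕ}

/-- `c ↦ ⌊c/2⌋ (mod n)`: the "`a`" of a torus coordinate `c = 2a + ε`.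
[cite: BravyiEtAl2024, proof of Lemma 4 "(2a, 2b) … (2a+1, 2b+1)" (arXiv:2308.07915 chunk p0011 L31–33)] -/
def half (c : ZMod (2 * n)) : ZMod n := ((c.val / 2 : ℕ) : ZMod n)

/-- The parity `ε` of a torus coordinate `c = 2a + ε` (`true` = odd).
[cite: BravyiEtAl2024, proof of Lemma 4 (arXiv:2308.07915 chunk p0011 L31–33)] -/
def par (c : ZMod (2 * n)) : Bool := decide (c.val % 2 = 1)

variable [NeZero n]

/-- `2n ≠ 0` when `n ≠ 0` (local instance supplier for `ZMod (2n)` lemmas). [folklore] -/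
private theorem neZero_two_mul : NeZero (2 * n) := ⟨by have := NeZero.ne n; omega⟩

/-- `(c + 1).val` in `ℤ_{2n}`. [folklore] -/
private theorem val_add_one_eq (c : ZMod (2 * n)) :
    haveI := neZero_two_mul (n := n)
    (c + 1).val = (c.val + 1) % (2 * n) := by
  haveI := neZero_two_mul (n := n)
  rw [ZMod.val_add, ZMod.val_one_eq_one_mod, Nat.add_mod_mod]

/-- Stepping `c ↦ c + 1` from an EVEN coordinate keeps `half` and flips the parity to odd.
[cite: BravyiEtAl2024, proof of Lemma 4 (arXiv:2308.07915 chunk p0011 L31–35)] -/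
theorem half_par_add_one_of_even (c : ZMod (2 * n)) (hc : par c = false) :
    half (c + 1) = half c ∧ par (c + 1) = true := by
  haveI := neZero_two_mul (n := n)
  have hv := ZMod.val_lt c
  have hc' : c.val % 2 = 0 := by simpa [par] using hc
  have h1 : (c + 1).val = c.val + 1 := by
    rw [val_add_one_eq, Nat.mod_eq_of_lt (by omega)]
  refine ⟨?_, ?_⟩
  · simp only [half, h1]
    congr 1
    omega
  · simp only [par, h1, decide_eq_true_eq]
    omega

/-- Stepping `c ↦ c + 1` from an ODD coordinate advances `half` by one and flips the parity to even
(including the wrap-around `2n − 1 ↦ 0`). [cite: BravyiEtAl2024, proof of Lemma 4 (arXiv:2308.07915 chunk p0011 L31–35)] -/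
theorem half_par_add_one_of_odd (c : ZMod (2 * n)) (hc : par c = true) :
    half (c + 1) = half c + 1 ∧ par (c + 1) = false := by
  haveI := neZero_two_mul (n := n)
  have hv := ZMod.val_lt c
  have hc' : c.val % 2 = 1 := by simpa [par] using hc
  by_cases hlt : c.val + 1 < 2 * n
  · have h1 : (c + 1).val = c.val + 1 := by rw [val_add_one_eq, Nat.mod_eq_of_lt hlt]
    refine ⟨?_, ?_⟩
    · simp only [half, h1]
      have : (c.val + 1) / 2 = c.val / 2 + 1 := by omega
      rw [this]; push_cast; ring
    · simp only [par, h1, decide_eq_false_iff_not]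
      omega
  · have heq : c.val + 1 = 2 * n := by omega
    have h1 : (c + 1).val = 0 := by rw [val_add_one_eq, heq, Nat.mod_self]
    refine ⟨?_, ?_⟩
    · simp only [half, h1, Nat.zero_div, Nat.cast_zero]
      have : c.val / 2 + 1 = n := by omega
      rw [← Nat.cast_add_one, this, ZMod.natCast_self]
    · simp [par, h1]

/-- The parity decomposition is injective: `half` and `par` determine the coordinate.
[cite: BravyiEtAl2024, proof of Lemma 4 "this choice of (a,b) is unique" (arXiv:2308.07915 chunk p0011 L31–32)] -/
theorem eq_of_half_eq_of_par_eq {c c' : ZMod (2 * n)} (h1 : half c = half c') (h2 : par c = par c') :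
    c = c' := by
  haveI := neZero_two_mul (n := n)
  have hv := ZMod.val_lt c
  have hv' := ZMod.val_lt c'
  have h1' : c.val / 2 = c'.val / 2 := by
    have := (ZMod.natCast_eq_natCast_iff' _ _ _).mp h1
    rwa [Nat.mod_eq_of_lt (by omega), Nat.mod_eq_of_lt (by omega)] at this
  have h2' : c.val % 2 = c'.val % 2 := by
    by_cases h : c.val % 2 = 1
    · have : c'.val % 2 = 1 := by simpa [par, h] using h2.symm
      omega
    · have : ¬ c'.val % 2 = 1 := by simpa [par, h] using h2
      omega
  apply ZMod.val_injective
  omega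

end Parity

/-! ### The torus parametrisation `(p, q) ↦ p•α + q•β` of an abelian group -/

section TorusHom

variable {G : Type*} [AddCommGroup G] (α β : G)

/-- `(p, q) ↦ p•α + q•β` on `ℤ_μ × ℤ_ν`, `μ = ord α`, `ν = ord β` (well defined because `μ•α = 0`).
[cite: BravyiEtAl2024, proof of Lemma 4 "there is (a,b) ∈ ℤ_μ × ℤ_λ such that α = (A_iA_j^T)^a (B_gB_h^T)^b" (arXiv:2308.07915 chunk p0011 L31)] -/
noncomputable def torusPoint (p : ZMod (addOrderOf α)) (q : ZMod (addOrderOf β)) : G := p.val • α + q.val • β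

/-- `val` is additive up to the order: `(p + p').val • α = p.val • α + p'.val • α`. [folklore] -/
private theorem val_add_nsmul [Finite G] (p p' : ZMod (addOrderOf α)) :
    (p + p').val • α = p.val • α + p'.val • α := by
  haveI : NeZero (addOrderOf α) := ⟨(addOrderOf_pos α).ne'⟩
  rw [ZMod.val_add, mod_addOrderOf_nsmul, add_nsmul]

/-- The torus parametrisation as a group homomorphism `ℤ_μ × ℤ_ν →+ G`.
[cite: BravyiEtAl2024, proof of Lemma 4 (arXiv:2308.07915 chunk p0011 L31–36)] -/
noncomputable def torusHom [Finite G] : ZMod (addOrderOf α) × ZMod (addOrderOf β) →+ G :=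
  AddMonoidHom.mk' (fun x => torusPoint α β x.1 x.2) (by
    intro x y
    simp only [torusPoint, Prod.fst_add, Prod.snd_add, val_add_nsmul]
    abel)

/-- `torusHom (p, q) = p•α + q•β`. [cite: BravyiEtAl2024, proof of Lemma 4 (arXiv:2308.07915 chunk p0011 L31)] -/
theorem torusHom_apply [Finite G] (x : ZMod (addOrderOf α) × ZMod (addOrderOf β)) :
    torusHom α β x = x.1.val • α + x.2.val • β := rfl

/-- `torusHom (1, 0) = α`. [cite: BravyiEtAl2024, proof of Lemma 4 (arXiv:2308.07915 chunk p0011 L31)] -/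
theorem torusHom_one_zero [Finite G] : torusHom α β (1, 0) = α := by
  rw [torusHom_apply, ZMod.val_zero, zero_nsmul, add_zero, ZMod.val_one_eq_one_mod,
    mod_addOrderOf_nsmul, one_nsmul]

/-- `torusHom (0, 1) = β`. [cite: BravyiEtAl2024, proof of Lemma 4 (arXiv:2308.07915 chunk p0011 L31)] -/
theorem torusHom_zero_one [Finite G] : torusHom α β (0, 1) = β := by
  rw [torusHom_apply, ZMod.val_zero, zero_nsmul, zero_add, ZMod.val_one_eq_one_mod,
    mod_addOrderOf_nsmul, one_nsmul]

/-- Stepping the first coordinate adds `α`. [cite: BravyiEtAl2024, proof of Lemma 4 (arXiv:2308.07915 chunk p0011 L35–36)] -/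
theorem torusHom_add_one_fst [Finite G] (p : ZMod (addOrderOf α)) (q : ZMod (addOrderOf β)) :
    torusHom α β (p + 1, q) = torusHom α β (p, q) + α := by
  have := (torusHom α β).map_add (p, q) (1, 0)
  simp only [Prod.mk_add_mk, add_zero] at this
  rw [this, torusHom_one_zero]

/-- Stepping the second coordinate adds `β`. [cite: BravyiEtAl2024, proof of Lemma 4 (arXiv:2308.07915 chunk p0011 L35–36)] -/
theorem torusHom_add_one_snd [Finite G] (p : ZMod (addOrderOf α)) (q : ZMod (addOrderOf β)) :
    torusHom α β (p, q + 1) = torusHom α β (p, q) + β := by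
  have := (torusHom α β).map_add (p, q) (0, 1)
  simp only [Prod.mk_add_mk, add_zero] at this
  rw [this, torusHom_zero_one]

/-- Condition (i) `⟨α, β⟩ = G` makes the parametrisation surjective.
[cite: BravyiEtAl2024, Lemma 4 (i) and proof "because of (i), there is (a,b)" (arXiv:2308.07915 chunk p0011 L29–31)] -/
theorem torusHom_surjective [Finite G] (hgen : AddSubgroup.closure ({α, β} : Set G) = ⊤) :
    Function.Surjective (torusHom α β) := by
  rw [← AddMonoidHom.range_eq_top, eq_top_iff, ← hgen, AddSubgroup.closure_le]
  rintro x (rfl | rfl)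
  · exact ⟨(1, 0), torusHom_one_zero x β⟩
  · exact ⟨(0, 1), torusHom_zero_one α x⟩

/-- Conditions (i) and (ii) `ord α · ord β = |G|` make the parametrisation a bijection
`ℤ_μ × ℤ_ν ≃ G` ("this choice of `(a,b)` is unique" by pigeonhole).
[cite: BravyiEtAl2024, Lemma 4 (ii) and proof "Because of (ii) and the pigeonhole principle, this choice of (a,b) is unique" (arXiv:2308.07915 chunk p0011 L31–32)] -/
theorem torusHom_bijective [Fintype G] (hgen : AddSubgroup.closure ({α, β} : Set G) = ⊤)
    (hord : addOrderOf α * addOrderOf β = Fintype.card G) : Function.Bijective (torusHom α β) := by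
  haveI : NeZero (addOrderOf α) := ⟨(addOrderOf_pos α).ne'⟩
  haveI : NeZero (addOrderOf β) := ⟨(addOrderOf_pos β).ne'⟩
  rw [Fintype.bijective_iff_surjective_and_card]
  exact ⟨torusHom_surjective α β hgen, by rw [Fintype.card_prod, ZMod.card, ZMod.card, hord]⟩

end TorusHom

/-! ### Definition 1 in Mathlib's spanning-subgraph language (appended 2026-08-27) -/

section SpanningSubgraph

variable {V : Type*}

/-- **Definition 1, subgraph form**: `Γ` has a toric layout on `ℤ_{2μ} × ℤ_{2ν}` iff some SPANNING
SUBGRAPH of `Γ` — a simple graph `Γ' ≤ Γ` on the same vertex set — is isomorphic to the Cayley graph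
of `ℤ_{2μ} × ℤ_{2ν}` ("its Tanner graph has a spanning sub-graph isomorphic to the Cayley graph of
`ℤ_{2μ} × ℤ_{2λ}`"); the bijection-carrying-edges form `HasToricLayoutWith` is this, verbatim.
[cite: BravyiEtAl2024, Definition 1 "A spanning sub-graph of a graph G is a sub-graph containing all the vertices of G … Code QC(A,B) is said to have a toric layout if its Tanner graph has a spanning sub-graph isomorphic to the Cayley graph of ℤ_{2μ} × ℤ_{2λ}" (arXiv:2308.07915 chunk p0011 L21–24)] -/
theorem hasToricLayoutWith_iff_exists_le {μ ν : ℕ} {Γ : SimpleGraph V} :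
    HasToricLayoutWith μ ν Γ ↔
      ∃ Γ' : SimpleGraph V, Γ' ≤ Γ ∧ Nonempty (torusGraph (2 * μ) (2 * ν) ≃g Γ') := by
  constructor
  · rintro ⟨f, hf, hadj⟩
    refine ⟨(torusGraph (2 * μ) (2 * ν)).map (Equiv.ofBijective f hf), ?_,
      ⟨Iso.map (Equiv.ofBijective f hf) _⟩⟩
    intro u v h
    rw [map_adj'] at h
    obtain ⟨-, u', v', huv, rfl, rfl⟩ := h
    exact hadj u' v' huv
  · rintro ⟨Γ', hle, ⟨φ⟩⟩
    exact ⟨φ, φ.toEquiv.bijective, fun u v h => hle (φ.map_adj_iff.mpr h)⟩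

/-- **Definition 1, subgraph form** (parameters existentially quantified, `μ, ν ≥ 1`).
[cite: BravyiEtAl2024, Definition 1 (arXiv:2308.07915 chunk p0011 L24)] -/
theorem hasToricLayout_iff_exists_le {Γ : SimpleGraph V} :
    HasToricLayout Γ ↔ ∃ μ ν : ℕ, 0 < μ ∧ 0 < ν ∧
      ∃ Γ' : SimpleGraph V, Γ' ≤ Γ ∧ Nonempty (torusGraph (2 * μ) (2 * ν) ≃g Γ') := by
  simp only [HasToricLayout, hasToricLayoutWith_iff_exists_le]

end SpanningSubgraph

end Literature.InformationTheory.QuantumCodes
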